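import Summits.QuantumFields.YangMills.Theorems.UnitScaleTiltProp7ColumnPairingRows
import Summits.QuantumFields.YangMills.Theorems.UnitScaleTiltProp7GramInverseDifferenceRow
import Summits.QuantumFields.YangMills.Theorems.UnitScaleTiltProp7GramDifferenceNearFarSplit
import Summits.QuantumFields.YangMills.Theorems.UnitScaleTiltProp7KernelFormOfOrthonormalBasis
import HarnessLib

/-!
# Route `UnitScaleTilt`, crux K1 «MinimiserStabilityRegPr» (stmt-QuantumFields-19200), EX row `hGF[Lift]` (curved member) — **LOD LINE, PEN (L5″) (RN) «RN-SUM» (ABSTRACT):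
# THE GRAM-DIFFERENCE ROW IS ONE VECTOR ROW, AND IT TELESCOPES INTO FOUR** — for the two massive-column systems `v_y = G_W(T_W(b_y))`, `v′_y = G_1(T_1(b_y))`
# over one orthonormal coarse basis `b` (symmetric `G`, adjoint pairs `(S, T)`, Gram matrices `M y y′ = ⟪v_y, v_{y′}⟫`, `M′ y y′ = ⟪v′_y, v′_{y′}⟫` — the letters of
# ✓`Prop7LocalProjectorRowOfMemberRows.norm_inner_starProjection_sub_le_of_member_rows`), and for ANY coarse coordinate vector `c` with `c̃ := Σ_y c_y • b_y`:
# * §1 `((M′ − M)c)_y = ⟪b_y, S_1(G_1(G_1(T_1 c̃))) − S_W(G_W(G_W(T_W c̃)))⟫`, hence by Parseval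
#   **`Σ_y ‖((M′ − M)c)_y‖² = ‖S_1(G_1(G_1(T_1 c̃))) − S_W(G_W(G_W(T_W c̃)))‖²`** — the (RN) coordinate sum IS the two-system difference of the coarse operator
#   `Q″G²Q″†` at ONE coarse vector (no entry-by-entry summation of `M′ − M` is needed);
# * §2 the four-term telescope `S_1G_1G_1T_1 − S_WG_WG_WT_W = (S_1−S_W)G_1G_1T_1 + S_W(G_1−G_W)G_1T_1 + S_WG_W(G_1−G_W)T_1 + S_WG_WG_W(T_1−T_W)` ⟹
#   **`√Σ_y‖((M′ − M)c)_y‖² ≤ t_S + C_S·t₂ + C_S·C_G·t₁ + C_S·C_G²·t_T`** from four ABSOLUTE vector rows at the explicit vectors `c̃, x₁ = T_1c̃, x₂ = G_1x₁, x₃ = G_1x₂`;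
# * §3 DOCKING INTO routeR-w3 g12's ✓`Prop7GramDifferenceNearFarSplit.gramDifference_row_of_near_far` (the near∕far form of the (RN) row): its `hc` binder
#   (`√Σ‖(M′⁻¹b_f)_y‖² ≤ ν′·C_S·C_G·‖f‖`, `(b_f)_y = ⟪v_y, f⟫` = coordinates of `S_W(G_W f)`), its `hA` binder (`‖M′ − M‖ ≤ C_S′C_G′²C_T′ + C_SC_G²C_T`, Parseval ⟹ row ⟹
#   `L²`-operator norm), its `hnear` binder VERBATIM from the four rows in relative form on `N`-supported coarse vectors (`ε_N := κ_S + C_S·κ₂ + C_S·C_G·κ₁ + C_S·C_G²·κ_T`),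
#   and the assembled `hRN` of ✓p755439 given `hnear` and the FAR TAIL `√Σ_{y∉N}‖(M′⁻¹b_f)_y‖² ≤ τ‖f‖` ((RN-far), the member's Gram-inverse decay × column localisation);
# * §4 the SPLIT shape of an absolute row (`x = x_in + x_out`: a local row on `x_in` plus global bounds on `x_out`), which is how the member discharges §2's
#   four rows at vectors that are only exponentially concentrated at the cube (✓`Prop7CoarseGramInverseDecay` ∕ ✓`…TdistDecay` for `c`, ✓`Prop7ComplementaryProjectorBlockDecay`
#   §2 for `b_f`), from px5's cut-off rows ✓`Prop7PropagatorComparisonOnCutoff` (RB1, `Xh = h`) and ✓`Prop7TopMeanComparisonOnPropagator` (RB2).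

Cell `ym3-torus` (HUMAN RULING D-0037, YM ladder rung R3 — NOT d = 4, NOT infinite volume, NOT a mass gap, NOT Clay).  Width seat `ym-routeR-w2` gen 13 (routeR-w3 g12
2026-08-30 01:28:13Z ∕ 01:39:35Z «`hRN` = the one Gram-difference row (routeR-w2's «RN-sum» offer stands) … routeR-w2 ∕ px5: MINE (R-N) welcome»; ★p1 g24 LOCATE-L6-ASSEMBLY §1
Step I.2 (L5″)).  THEOREMS ONLY (0 `def`, 0 `sorry`), Mathlib + ✓`Prop7ColumnPairingRows` + ✓`Prop7GramInverseDifferenceRow` + ✓`Prop7GramDifferenceNearFarSplit` (routeR-w3 g12) +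
✓`Prop7KernelFormOfOrthonormalBasis` (`norm_sq_sum_smul_eq`, w5 g13) + ✓`Prop7ProjectorPerturbation` (`sqrt_normSq_mulVec_le`, `l2_opNorm_le_of_forall_sqrt_le`); `--supports stmt-QuantumFields-19200 --as helper`, count-neutral.  HONEST LABEL (★★OWNER RULING №33 (6)): curved γ-row
supplier line (LOD localisation), pen (L5″); abstract Hilbert-space algebra in hypothesis form — nothing of (RN) at the member, (3.49), Thm 3.1∕3.3, `h349`, `hGF`, EX ∕ 19200 is proved here.

WHAT IS PROVED (ns `Summit.QuantumFields.YangMills.Theorems.Prop7GramDifferenceRowSum`).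
* §1 `mulVec_gram_apply` (`(Mc)_y = ⟪b_y, S(G(G(T c̃)))⟫`), ★★ `sum_normSq_gramDiff_mulVec_eq` (Parseval for the Gram difference), `norm_coordSum_sq` (`‖c̃‖² = Σ‖c_y‖²`).
* §2 `gramDiff_vector_telescope` (the four-term identity), ★★★ `sqrt_sum_normSq_gramDiff_mulVec_le` (the RN-SUM).
* §3 `coordSum_inner_column_eq` (`Σ_y ⟪v_y, f⟫ • b_y = S_W(G_W f)`), `sqrt_sum_normSq_gramInv_coords_le` (= `hc`), `norm_coordSum_gramInv_le`, `sqrt_normSq_gram_mulVec_le`,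
  `gram_l2_opNorm_le` (`‖M‖ ≤ C_S·C_G²·C_T`), `gramDiff_l2_opNorm_le` (= `hA`), ★★★ `hnear_of_operator_row` ∕ ★★★ `hnear_of_four_rows` (= `hnear` from one operator row ∕ four rows), ★★ `hRN_of_near_far` (the `hRN` binder of ✓p755439 from `hnear` + (RN-far)).
* §4 `norm_map_sub_map_le_of_split`, `norm_map_sub_map_le_of_split_rel` (absolute row ⟸ local row on `x_in` + global bounds on `x_out`).

References: T. Bałaban, CMP **99** (1985) 389–434 [Balaban1985BackgroundPropagators] ((3.16) p.393, (3.20)–(3.26) pp.394–395, (3.105)–(3.106) p.414).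
-/

set_option autoImplicit false

noncomputable section

open scoped InnerProductSpace ComplexConjugate BigOperators Matrix Matrix.Norms.L2Operator

namespace Summit.QuantumFields.YangMills.Theorems.Prop7GramDifferenceRowSum

open Summit.QuantumFields.YangMills.Theorems.Prop7ColumnPairingRows (inner_column_eq sqrt_sum_normSq_inner_column_le)
open Summit.QuantumFields.YangMills.Theorems.Prop7ProjectorPerturbation (sqrt_normSq_mulVec_le)
open Summit.QuantumFields.YangMills.Theorems.Prop7KernelFormOfOrthonormalBasis (norm_sq_sum_smul_eq)

variable {E C : Type*} [NormedAddCommGroup E] [InnerProductSpace ℂ E] [NormedAddCommGroup C] [InnerProductSpace ℂ C] {m : Type*} [Fintype m] [DecidableEq m]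

/-! ## §1 The (RN) coordinate vector is a vector: Parseval for the Gram difference -/

omit [DecidableEq m] in
/-- **THE GRAM MATRIX ACTS THROUGH THE COARSE OPERATOR `Q″G²Q″†`**: for the massive columns `v_y = G(T(b_y))` (`G` symmetric, `S` the adjoint of `T`) with Gram matrix
`M y y′ = ⟪v_y, v_{y′}⟫` and any coordinate vector `c`, `(Mc)_y = ⟪b_y, S(G(G(T(Σ_{y′} c_{y′} • b_{y′}))))⟫`. [cite: Balaban1985BackgroundPropagators, (3.16) p.393, (3.21) p.394] -/
theorem mulVec_gram_apply (b : OrthonormalBasis m ℂ C) (G : E →ₗ[ℂ] E) (T : C →ₗ[ℂ] E) (S : E →ₗ[ℂ] C) (hG : ∀ x y : E, ⟪G x, y⟫_ℂ = ⟪x, G y⟫_ℂ)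
    (hT : ∀ (l : E) (c : C), ⟪S l, c⟫_ℂ = ⟪l, T c⟫_ℂ) {M : Matrix m m ℂ} (hM : ∀ y y', M y y' = ⟪G (T (b y)), G (T (b y'))⟫_ℂ) (c : m → ℂ) (y : m) :
    (M *ᵥ c) y = ⟪b y, S (G (G (T (∑ y', c y' • b y'))))⟫_ℂ := by
  have e : G (T (∑ y', c y' • b y')) = ∑ y', c y' • G (T (b y')) := by simp only [map_sum, map_smul]
  rw [← inner_column_eq G T S hG hT, e, inner_sum]
  simp only [Matrix.mulVec, dotProduct, hM, inner_smul_right]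
  exact Finset.sum_congr rfl fun y' _ => mul_comm _ _

omit [DecidableEq m] in
/-- ★★ **PARSEVAL FOR THE GRAM DIFFERENCE**: for two systems `v_y = G_W(T_W(b_y))`, `v′_y = G_1(T_1(b_y))` over one orthonormal coarse basis (symmetric `G`, adjoint pairs) with
Grams `M, M′`, and any coordinate vector `c` with `c̃ = Σ_y c_y • b_y`:
`Σ_y ‖((M′ − M)c)_y‖² = ‖S_1(G_1(G_1(T_1 c̃))) − S_W(G_W(G_W(T_W c̃)))‖²` — the (RN) coordinate sum is ONE two-system vector difference. [cite: Balaban1985BackgroundPropagators, (3.21) p.394, (3.105) p.414] -/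
theorem sum_normSq_gramDiff_mulVec_eq (b : OrthonormalBasis m ℂ C) (GW G1 : E →ₗ[ℂ] E) (TW T1 : C →ₗ[ℂ] E) (SW S1 : E →ₗ[ℂ] C)
    (hGW : ∀ x y : E, ⟪GW x, y⟫_ℂ = ⟪x, GW y⟫_ℂ) (hG1 : ∀ x y : E, ⟪G1 x, y⟫_ℂ = ⟪x, G1 y⟫_ℂ)
    (hTW : ∀ (l : E) (c : C), ⟪SW l, c⟫_ℂ = ⟪l, TW c⟫_ℂ) (hT1 : ∀ (l : E) (c : C), ⟪S1 l, c⟫_ℂ = ⟪l, T1 c⟫_ℂ)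
    {M M' : Matrix m m ℂ} (hM : ∀ y y', M y y' = ⟪GW (TW (b y)), GW (TW (b y'))⟫_ℂ) (hM' : ∀ y y', M' y y' = ⟪G1 (T1 (b y)), G1 (T1 (b y'))⟫_ℂ) (c : m → ℂ) :
    ∑ y, ‖((M' - M) *ᵥ c) y‖ ^ 2 = ‖S1 (G1 (G1 (T1 (∑ y', c y' • b y')))) - SW (GW (GW (TW (∑ y', c y' • b y'))))‖ ^ 2 := by
  rw [← b.sum_sq_norm_inner_right]
  refine Finset.sum_congr rfl fun y _ => ?_
  rw [Matrix.sub_mulVec, Pi.sub_apply, mulVec_gram_apply b G1 T1 S1 hG1 hT1 hM' c y, mulVec_gram_apply b GW TW SW hGW hTW hM c y, ← inner_sub_right]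

omit [DecidableEq m] in
/-- **THE COORDINATE SUM IS AN ISOMETRY**: `‖Σ_y c_y • b_y‖² = Σ_y ‖c_y‖²` (✓`Prop7KernelFormOfOrthonormalBasis.norm_sq_sum_smul_eq` at `Finset.univ`). [folklore] -/
theorem norm_coordSum_sq (b : OrthonormalBasis m ℂ C) (c : m → ℂ) : ‖∑ y, c y • b y‖ ^ 2 = ∑ y, ‖c y‖ ^ 2 :=
  norm_sq_sum_smul_eq b Finset.univ c

/-! ## §2 The four-term telescope: the RN-SUM -/

/-- **THE FOUR-TERM TELESCOPE** (an identity of vectors): with `x₁ = T_1 c̃`, `x₂ = G_1 x₁`, `x₃ = G_1 x₂`,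
`S_1 x₃ − S_W(G_W(G_W(T_W c̃))) = (S_1 x₃ − S_W x₃) + S_W(G_1 x₂ − G_W x₂) + S_W(G_W(G_1 x₁ − G_W x₁)) + S_W(G_W(G_W(T_1 c̃ − T_W c̃)))`.
[cite: Balaban1985BackgroundPropagators, (3.105)–(3.106) p.414] -/
theorem gramDiff_vector_telescope (GW G1 : E →ₗ[ℂ] E) (TW T1 : C →ₗ[ℂ] E) (SW S1 : E →ₗ[ℂ] C) (ct : C) :
    S1 (G1 (G1 (T1 ct))) - SW (GW (GW (TW ct)))
      = (S1 (G1 (G1 (T1 ct))) - SW (G1 (G1 (T1 ct)))) + SW (G1 (G1 (T1 ct)) - GW (G1 (T1 ct)))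
        + SW (GW (G1 (T1 ct) - GW (T1 ct))) + SW (GW (GW (T1 ct - TW ct))) := by
  simp only [map_sub]; abel

omit [DecidableEq m] in
/-- ★★★ **THE RN-SUM**: two systems as in `sum_normSq_gramDiff_mulVec_eq`, global sizes `‖S_W l‖ ≤ C_S‖l‖`, `‖G_W h‖ ≤ C_G‖h‖`, and FOUR ABSOLUTE VECTOR ROWS at the explicit
vectors `c̃ = Σ_y c_y • b_y`, `x₁ = T_1 c̃`, `x₂ = G_1 x₁`, `x₃ = G_1 x₂` — `‖T_1 c̃ − T_W c̃‖ ≤ t_T`, `‖G_1 x₁ − G_W x₁‖ ≤ t₁`, `‖G_1 x₂ − G_W x₂‖ ≤ t₂`, `‖S_1 x₃ − S_W x₃‖ ≤ t_S` — give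
**`√Σ_y‖((M′ − M)c)_y‖² ≤ t_S + C_S·t₂ + C_S·C_G·t₁ + C_S·C_G²·t_T`**.  (Absolute rows: at the member each is «local row on the fattened cube» + «tail of `c̃`».)
[cite: Balaban1985BackgroundPropagators, (3.21)–(3.26) pp.394–395, (3.105)–(3.106) p.414] -/
theorem sqrt_sum_normSq_gramDiff_mulVec_le (b : OrthonormalBasis m ℂ C) (GW G1 : E →ₗ[ℂ] E) (TW T1 : C →ₗ[ℂ] E) (SW S1 : E →ₗ[ℂ] C)
    (hGW : ∀ x y : E, ⟪GW x, y⟫_ℂ = ⟪x, GW y⟫_ℂ) (hG1 : ∀ x y : E, ⟪G1 x, y⟫_ℂ = ⟪x, G1 y⟫_ℂ)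
    (hTW : ∀ (l : E) (c : C), ⟪SW l, c⟫_ℂ = ⟪l, TW c⟫_ℂ) (hT1 : ∀ (l : E) (c : C), ⟪S1 l, c⟫_ℂ = ⟪l, T1 c⟫_ℂ)
    {M M' : Matrix m m ℂ} (hM : ∀ y y', M y y' = ⟪GW (TW (b y)), GW (TW (b y'))⟫_ℂ) (hM' : ∀ y y', M' y y' = ⟪G1 (T1 (b y)), G1 (T1 (b y'))⟫_ℂ)
    {CS CG : ℝ} (hCS : 0 ≤ CS) (hCG : 0 ≤ CG) (hSW : ∀ l, ‖SW l‖ ≤ CS * ‖l‖) (hGWb : ∀ h, ‖GW h‖ ≤ CG * ‖h‖)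
    (c : m → ℂ) {tT t₁ t₂ tS : ℝ}
    (hT : ‖T1 (∑ y', c y' • b y') - TW (∑ y', c y' • b y')‖ ≤ tT)
    (h₁ : ‖G1 (T1 (∑ y', c y' • b y')) - GW (T1 (∑ y', c y' • b y'))‖ ≤ t₁)
    (h₂ : ‖G1 (G1 (T1 (∑ y', c y' • b y'))) - GW (G1 (T1 (∑ y', c y' • b y')))‖ ≤ t₂)
    (hS : ‖S1 (G1 (G1 (T1 (∑ y', c y' • b y')))) - SW (G1 (G1 (T1 (∑ y', c y' • b y'))))‖ ≤ tS) :
    Real.sqrt (∑ y, ‖((M' - M) *ᵥ c) y‖ ^ 2) ≤ tS + CS * t₂ + CS * CG * t₁ + CS * CG ^ 2 * tT := by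
  rw [sum_normSq_gramDiff_mulVec_eq b GW G1 TW T1 SW S1 hGW hG1 hTW hT1 hM hM' c, Real.sqrt_sq (norm_nonneg _),
    gramDiff_vector_telescope GW G1 TW T1 SW S1]
  set ct := ∑ y', c y' • b y'
  have hA : ‖SW (G1 (G1 (T1 ct)) - GW (G1 (T1 ct)))‖ ≤ CS * t₂ := (hSW _).trans (mul_le_mul_of_nonneg_left h₂ hCS)
  have hB : ‖SW (GW (G1 (T1 ct) - GW (T1 ct)))‖ ≤ CS * CG * t₁ := by
    calc ‖SW (GW (G1 (T1 ct) - GW (T1 ct)))‖ ≤ CS * ‖GW (G1 (T1 ct) - GW (T1 ct))‖ := hSW _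
      _ ≤ CS * (CG * ‖G1 (T1 ct) - GW (T1 ct)‖) := mul_le_mul_of_nonneg_left (hGWb _) hCS
      _ ≤ CS * (CG * t₁) := mul_le_mul_of_nonneg_left (mul_le_mul_of_nonneg_left h₁ hCG) hCS
      _ = CS * CG * t₁ := by ring
  have hC : ‖SW (GW (GW (T1 ct - TW ct)))‖ ≤ CS * CG ^ 2 * tT := by
    calc ‖SW (GW (GW (T1 ct - TW ct)))‖ ≤ CS * ‖GW (GW (T1 ct - TW ct))‖ := hSW _
      _ ≤ CS * (CG * ‖GW (T1 ct - TW ct)‖) := mul_le_mul_of_nonneg_left (hGWb _) hCS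
      _ ≤ CS * (CG * (CG * ‖T1 ct - TW ct‖)) := mul_le_mul_of_nonneg_left (mul_le_mul_of_nonneg_left (hGWb _) hCG) hCS
      _ ≤ CS * (CG * (CG * tT)) := mul_le_mul_of_nonneg_left (mul_le_mul_of_nonneg_left (mul_le_mul_of_nonneg_left hT hCG) hCG) hCS
      _ = CS * CG ^ 2 * tT := by ring
  have e1 : ‖(S1 (G1 (G1 (T1 ct))) - SW (G1 (G1 (T1 ct)))) + SW (G1 (G1 (T1 ct)) - GW (G1 (T1 ct))) + SW (GW (G1 (T1 ct) - GW (T1 ct))) + SW (GW (GW (T1 ct - TW ct)))‖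
      ≤ ‖(S1 (G1 (G1 (T1 ct))) - SW (G1 (G1 (T1 ct)))) + SW (G1 (G1 (T1 ct)) - GW (G1 (T1 ct))) + SW (GW (G1 (T1 ct) - GW (T1 ct)))‖ + ‖SW (GW (GW (T1 ct - TW ct)))‖ :=
    norm_add_le _ _
  have e2 : ‖(S1 (G1 (G1 (T1 ct))) - SW (G1 (G1 (T1 ct)))) + SW (G1 (G1 (T1 ct)) - GW (G1 (T1 ct))) + SW (GW (G1 (T1 ct) - GW (T1 ct)))‖
      ≤ ‖S1 (G1 (G1 (T1 ct))) - SW (G1 (G1 (T1 ct)))‖ + ‖SW (G1 (G1 (T1 ct)) - GW (G1 (T1 ct)))‖ + ‖SW (GW (G1 (T1 ct) - GW (T1 ct)))‖ := norm_add₃_le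
  linarith

/-! ## §3 Docking into ✓`Prop7GramDifferenceNearFarSplit` (routeR-w3 g12's 2r-door): the size row `hc`, the operator row `hA`, the near row `hnear` from four relative rows, and `hRN` assembled -/

omit [DecidableEq m] in
/-- **`b_f` IS THE COORDINATE VECTOR OF `S_W(G_W f)`**: `Σ_y ⟪G_W(T_W(b_y)), f⟫ • b_y = S_W(G_W f)`. [cite: Balaban1985BackgroundPropagators, (3.16) p.393, (3.24) p.394] -/
theorem coordSum_inner_column_eq (b : OrthonormalBasis m ℂ C) (G : E →ₗ[ℂ] E) (T : C →ₗ[ℂ] E) (S : E →ₗ[ℂ] C) (hG : ∀ x y : E, ⟪G x, y⟫_ℂ = ⟪x, G y⟫_ℂ)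
    (hT : ∀ (l : E) (c : C), ⟪S l, c⟫_ℂ = ⟪l, T c⟫_ℂ) (f : E) : ∑ y, ⟪G (T (b y)), f⟫_ℂ • b y = S (G f) := by
  simp_rw [inner_column_eq G T S hG hT]
  exact b.sum_repr' _

/-- **SIZE OF THE GRAM-INVERSE COORDINATES**: `‖M′⁻¹‖ ≤ ν′`, `‖S_W l‖ ≤ C_S‖l‖`, `‖G_W h‖ ≤ C_G‖h‖` ⟹ `√Σ_y‖(M′⁻¹ b_f)_y‖² ≤ ν′·C_S·C_G·‖f‖`, `(b_f)_y = ⟪G_W(T_W(b_y)), f⟫`.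
[cite: Balaban1985BackgroundPropagators, (3.21)–(3.23) p.394, Thm 3.11 p.416] -/
theorem sqrt_sum_normSq_gramInv_coords_le (b : OrthonormalBasis m ℂ C) (G : E →ₗ[ℂ] E) (T : C →ₗ[ℂ] E) (S : E →ₗ[ℂ] C) (hG : ∀ x y : E, ⟪G x, y⟫_ℂ = ⟪x, G y⟫_ℂ)
    (hT : ∀ (l : E) (c : C), ⟪S l, c⟫_ℂ = ⟪l, T c⟫_ℂ) (N : Matrix m m ℂ) {ν CS CG : ℝ} (hν : 0 ≤ ν) (hCS : 0 ≤ CS) (hN : ‖N‖ ≤ ν)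
    (hS : ∀ l, ‖S l‖ ≤ CS * ‖l‖) (hGb : ∀ h, ‖G h‖ ≤ CG * ‖h‖) (f : E) :
    Real.sqrt (∑ y, ‖(N *ᵥ fun y' => ⟪G (T (b y')), f⟫_ℂ) y‖ ^ 2) ≤ ν * (CS * CG) * ‖f‖ := by
  refine (sqrt_normSq_mulVec_le N _).trans ?_
  rw [mul_assoc]
  exact mul_le_mul hN (sqrt_sum_normSq_inner_column_le b G T S hG hT hCS hS hGb f) (Real.sqrt_nonneg _) hν

/-- **SIZE OF THE COARSE VECTOR `c̃`**: with `c = N b_f` as above, `‖Σ_y c_y • b_y‖ ≤ ν′·C_S·C_G·‖f‖`. [cite: Balaban1985BackgroundPropagators, (3.21)–(3.23) p.394] -/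
theorem norm_coordSum_gramInv_le (b : OrthonormalBasis m ℂ C) (G : E →ₗ[ℂ] E) (T : C →ₗ[ℂ] E) (S : E →ₗ[ℂ] C) (hG : ∀ x y : E, ⟪G x, y⟫_ℂ = ⟪x, G y⟫_ℂ)
    (hT : ∀ (l : E) (c : C), ⟪S l, c⟫_ℂ = ⟪l, T c⟫_ℂ) (N : Matrix m m ℂ) {ν CS CG : ℝ} (hν : 0 ≤ ν) (hCS : 0 ≤ CS) (hN : ‖N‖ ≤ ν)
    (hS : ∀ l, ‖S l‖ ≤ CS * ‖l‖) (hGb : ∀ h, ‖G h‖ ≤ CG * ‖h‖) (f : E) :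
    ‖∑ y, (N *ᵥ fun y' => ⟪G (T (b y')), f⟫_ℂ) y • b y‖ ≤ ν * (CS * CG) * ‖f‖ := by
  have h := sqrt_sum_normSq_gramInv_coords_le b G T S hG hT N hν hCS hN hS hGb f
  rwa [← norm_coordSum_sq b, Real.sqrt_sq (norm_nonneg _)] at h

omit [DecidableEq m] in
/-- **ONE SYSTEM: THE GRAM ROW** — `‖S l‖ ≤ C_S‖l‖`, `‖G h‖ ≤ C_G‖h‖`, `‖T d‖ ≤ C_T‖d‖` ⟹ `√Σ_y‖(Mc)_y‖² ≤ C_S·C_G²·C_T·√Σ_y‖c_y‖²` (Parseval at one system).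
[cite: Balaban1985BackgroundPropagators, (3.21) p.394, Thm 3.11 p.416] -/
theorem sqrt_normSq_gram_mulVec_le (b : OrthonormalBasis m ℂ C) (G : E →ₗ[ℂ] E) (T : C →ₗ[ℂ] E) (S : E →ₗ[ℂ] C) (hG : ∀ x y : E, ⟪G x, y⟫_ℂ = ⟪x, G y⟫_ℂ)
    (hT : ∀ (l : E) (c : C), ⟪S l, c⟫_ℂ = ⟪l, T c⟫_ℂ) {M : Matrix m m ℂ} (hM : ∀ y y', M y y' = ⟪G (T (b y)), G (T (b y'))⟫_ℂ)
    {CS CG CT : ℝ} (hCS : 0 ≤ CS) (hCG : 0 ≤ CG) (hS : ∀ l, ‖S l‖ ≤ CS * ‖l‖) (hGb : ∀ h, ‖G h‖ ≤ CG * ‖h‖) (hTb : ∀ d, ‖T d‖ ≤ CT * ‖d‖) (c : m → ℂ) :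
    Real.sqrt (∑ y, ‖(M *ᵥ c) y‖ ^ 2) ≤ CS * CG ^ 2 * CT * Real.sqrt (∑ y, ‖c y‖ ^ 2) := by
  have hP : ∑ y, ‖(M *ᵥ c) y‖ ^ 2 = ‖S (G (G (T (∑ y', c y' • b y'))))‖ ^ 2 := by
    rw [← b.sum_sq_norm_inner_right]
    exact Finset.sum_congr rfl fun y _ => by rw [mulVec_gram_apply b G T S hG hT hM c y]
  rw [hP, Real.sqrt_sq (norm_nonneg _), ← norm_coordSum_sq b, Real.sqrt_sq (norm_nonneg _)]
  set ct := ∑ y', c y' • b y'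
  calc ‖S (G (G (T ct)))‖ ≤ CS * ‖G (G (T ct))‖ := hS _
    _ ≤ CS * (CG * (CG * (CT * ‖ct‖))) := by
        refine mul_le_mul_of_nonneg_left ((hGb _).trans (mul_le_mul_of_nonneg_left ((hGb _).trans (mul_le_mul_of_nonneg_left (hTb _) hCG)) hCG)) hCS
    _ = CS * CG ^ 2 * CT * ‖ct‖ := by ring

/-- **ONE SYSTEM: THE OPERATOR NORM OF THE GRAM MATRIX** — `‖M‖ ≤ C_S·C_G²·C_T` (`L²`-operator norm; ✓`Prop7ProjectorPerturbation.l2_opNorm_le_of_forall_sqrt_le`).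
[cite: Balaban1985BackgroundPropagators, (3.21) p.394, Thm 3.11 p.416] -/
theorem gram_l2_opNorm_le (b : OrthonormalBasis m ℂ C) (G : E →ₗ[ℂ] E) (T : C →ₗ[ℂ] E) (S : E →ₗ[ℂ] C) (hG : ∀ x y : E, ⟪G x, y⟫_ℂ = ⟪x, G y⟫_ℂ)
    (hT : ∀ (l : E) (c : C), ⟪S l, c⟫_ℂ = ⟪l, T c⟫_ℂ) {M : Matrix m m ℂ} (hM : ∀ y y', M y y' = ⟪G (T (b y)), G (T (b y'))⟫_ℂ)
    {CS CG CT : ℝ} (hCS : 0 ≤ CS) (hCG : 0 ≤ CG) (hCT : 0 ≤ CT) (hS : ∀ l, ‖S l‖ ≤ CS * ‖l‖) (hGb : ∀ h, ‖G h‖ ≤ CG * ‖h‖) (hTb : ∀ d, ‖T d‖ ≤ CT * ‖d‖) :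
    ‖M‖ ≤ CS * CG ^ 2 * CT :=
  Prop7ProjectorPerturbation.l2_opNorm_le_of_forall_sqrt_le M (by positivity) (sqrt_normSq_gram_mulVec_le b G T S hG hT hM hCS hCG hS hGb hTb)

/-- **THE `hA` BINDER OF ✓`Prop7GramDifferenceNearFarSplit.gramDifference_row_of_near_far`** (`A := M′ − M`): `‖M′ − M‖ ≤ C_S′·C_G′²·C_T′ + C_S·C_G²·C_T`.
[cite: Balaban1985BackgroundPropagators, (3.21) p.394, (3.105) p.414] -/
theorem gramDiff_l2_opNorm_le (b : OrthonormalBasis m ℂ C) (GW G1 : E →ₗ[ℂ] E) (TW T1 : C →ₗ[ℂ] E) (SW S1 : E →ₗ[ℂ] C)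
    (hGW : ∀ x y : E, ⟪GW x, y⟫_ℂ = ⟪x, GW y⟫_ℂ) (hG1 : ∀ x y : E, ⟪G1 x, y⟫_ℂ = ⟪x, G1 y⟫_ℂ)
    (hTW : ∀ (l : E) (c : C), ⟪SW l, c⟫_ℂ = ⟪l, TW c⟫_ℂ) (hT1 : ∀ (l : E) (c : C), ⟪S1 l, c⟫_ℂ = ⟪l, T1 c⟫_ℂ)
    {M M' : Matrix m m ℂ} (hM : ∀ y y', M y y' = ⟪GW (TW (b y)), GW (TW (b y'))⟫_ℂ) (hM' : ∀ y y', M' y y' = ⟪G1 (T1 (b y)), G1 (T1 (b y'))⟫_ℂ)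
    {CS CG CT CS' CG' CT' : ℝ} (hCS : 0 ≤ CS) (hCG : 0 ≤ CG) (hCT : 0 ≤ CT) (hCS' : 0 ≤ CS') (hCG' : 0 ≤ CG') (hCT' : 0 ≤ CT')
    (hSW : ∀ l, ‖SW l‖ ≤ CS * ‖l‖) (hGWb : ∀ h, ‖GW h‖ ≤ CG * ‖h‖) (hTWb : ∀ d, ‖TW d‖ ≤ CT * ‖d‖)
    (hS1 : ∀ l, ‖S1 l‖ ≤ CS' * ‖l‖) (hG1b : ∀ h, ‖G1 h‖ ≤ CG' * ‖h‖) (hT1b : ∀ d, ‖T1 d‖ ≤ CT' * ‖d‖) :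
    ‖M' - M‖ ≤ CS' * CG' ^ 2 * CT' + CS * CG ^ 2 * CT :=
  (norm_sub_le _ _).trans (add_le_add (gram_l2_opNorm_le b G1 T1 S1 hG1 hT1 hM' hCS' hCG' hCT' hS1 hG1b hT1b)
    (gram_l2_opNorm_le b GW TW SW hGW hTW hM hCS hCG hCT hSW hGWb hTWb))

omit [DecidableEq m] in
/-- ★★★ **THE `hnear` BINDER OF ✓`Prop7GramDifferenceNearFarSplit` FROM ONE OPERATOR ROW** (the dock for an operator-level (RN-near) knit): if for every coordinate vector `d`
supported in `N` the coarse two-system difference satisfies `‖S_1(G_1(G_1(T_1 d̃))) − S_W(G_W(G_W(T_W d̃)))‖ ≤ ε_N·‖d̃‖` (`d̃ := Σ_y d_y • b_y`), then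
**`∀ d, (∀ y ∉ N, d_y = 0) → √Σ_y‖((M′ − M)d)_y‖² ≤ ε_N·√Σ_y‖d_y‖²`** — `hnear` VERBATIM (Parseval, §1). [cite: Balaban1985BackgroundPropagators, (3.21) p.394, (3.105)–(3.106) p.414] -/
theorem hnear_of_operator_row (b : OrthonormalBasis m ℂ C) (GW G1 : E →ₗ[ℂ] E) (TW T1 : C →ₗ[ℂ] E) (SW S1 : E →ₗ[ℂ] C)
    (hGW : ∀ x y : E, ⟪GW x, y⟫_ℂ = ⟪x, GW y⟫_ℂ) (hG1 : ∀ x y : E, ⟪G1 x, y⟫_ℂ = ⟪x, G1 y⟫_ℂ)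
    (hTW : ∀ (l : E) (c : C), ⟪SW l, c⟫_ℂ = ⟪l, TW c⟫_ℂ) (hT1 : ∀ (l : E) (c : C), ⟪S1 l, c⟫_ℂ = ⟪l, T1 c⟫_ℂ)
    {M M' : Matrix m m ℂ} (hM : ∀ y y', M y y' = ⟪GW (TW (b y)), GW (TW (b y'))⟫_ℂ) (hM' : ∀ y y', M' y y' = ⟪G1 (T1 (b y)), G1 (T1 (b y'))⟫_ℂ)
    (N : Finset m) {εN : ℝ}
    (hop : ∀ d : m → ℂ, (∀ y, y ∉ N → d y = 0) →
      ‖S1 (G1 (G1 (T1 (∑ y', d y' • b y')))) - SW (GW (GW (TW (∑ y', d y' • b y'))))‖ ≤ εN * ‖∑ y', d y' • b y'‖) :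
    ∀ d : m → ℂ, (∀ y, y ∉ N → d y = 0) → Real.sqrt (∑ y, ‖((M' - M) *ᵥ d) y‖ ^ 2) ≤ εN * Real.sqrt (∑ y, ‖d y‖ ^ 2) := by
  intro d hd
  rw [sum_normSq_gramDiff_mulVec_eq b GW G1 TW T1 SW S1 hGW hG1 hTW hT1 hM hM' d, Real.sqrt_sq (norm_nonneg _), ← norm_coordSum_sq b,
    Real.sqrt_sq (norm_nonneg _)]
  exact hop d hd

omit [DecidableEq m] in
/-- ★★★ **THE `hnear` BINDER OF ✓`Prop7GramDifferenceNearFarSplit.gramDifference_row_of_near_far` ∕ `sqrt_normSq_mulVec_le_near_far` FROM FOUR RELATIVE ROWS ON `N`-SUPPORTED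
COARSE VECTORS**: two systems as in `sum_normSq_gramDiff_mulVec_eq`, `‖S_W l‖ ≤ C_S‖l‖`, `‖G_W h‖ ≤ C_G‖h‖`; if for every coordinate vector `d` supported in `N` (`d̃ := Σ_y d_y • b_y`,
`x₁ := T_1 d̃`, `x₂ := G_1 x₁`, `x₃ := G_1 x₂`) the four rows `‖T_1 d̃ − T_W d̃‖ ≤ κ_T‖d̃‖`, `‖G_1 x₁ − G_W x₁‖ ≤ κ₁‖d̃‖`, `‖G_1 x₂ − G_W x₂‖ ≤ κ₂‖d̃‖`, `‖S_1 x₃ − S_W x₃‖ ≤ κ_S‖d̃‖` hold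
(at the member: px5 g11's (T-row), ✓`Prop7PropagatorComparisonOnCutoff` (G-rows), ✓`Prop7TopMeanComparisonOnPropagator` (S-row) on the enlarged cube), then
**`∀ d, (∀ y ∉ N, d_y = 0) → √Σ_y‖((M′ − M)d)_y‖² ≤ (κ_S + C_S·κ₂ + C_S·C_G·κ₁ + C_S·C_G²·κ_T)·√Σ_y‖d_y‖²`** — `hnear` VERBATIM with `ε_N := κ_S + C_S·κ₂ + C_S·C_G·κ₁ + C_S·C_G²·κ_T`.
[cite: Balaban1985BackgroundPropagators, (3.21)–(3.26) pp.394–395, (3.105)–(3.106) p.414] -/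
theorem hnear_of_four_rows (b : OrthonormalBasis m ℂ C) (GW G1 : E →ₗ[ℂ] E) (TW T1 : C →ₗ[ℂ] E) (SW S1 : E →ₗ[ℂ] C)
    (hGW : ∀ x y : E, ⟪GW x, y⟫_ℂ = ⟪x, GW y⟫_ℂ) (hG1 : ∀ x y : E, ⟪G1 x, y⟫_ℂ = ⟪x, G1 y⟫_ℂ)
    (hTW : ∀ (l : E) (c : C), ⟪SW l, c⟫_ℂ = ⟪l, TW c⟫_ℂ) (hT1 : ∀ (l : E) (c : C), ⟪S1 l, c⟫_ℂ = ⟪l, T1 c⟫_ℂ)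
    {M M' : Matrix m m ℂ} (hM : ∀ y y', M y y' = ⟪GW (TW (b y)), GW (TW (b y'))⟫_ℂ) (hM' : ∀ y y', M' y y' = ⟪G1 (T1 (b y)), G1 (T1 (b y'))⟫_ℂ)
    {CS CG : ℝ} (hCS : 0 ≤ CS) (hCG : 0 ≤ CG) (hSW : ∀ l, ‖SW l‖ ≤ CS * ‖l‖) (hGWb : ∀ h, ‖GW h‖ ≤ CG * ‖h‖) (N : Finset m) {κT κ₁ κ₂ κS : ℝ}
    (hT : ∀ d : m → ℂ, (∀ y, y ∉ N → d y = 0) → ‖T1 (∑ y', d y' • b y') - TW (∑ y', d y' • b y')‖ ≤ κT * ‖∑ y', d y' • b y'‖)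
    (h₁ : ∀ d : m → ℂ, (∀ y, y ∉ N → d y = 0) → ‖G1 (T1 (∑ y', d y' • b y')) - GW (T1 (∑ y', d y' • b y'))‖ ≤ κ₁ * ‖∑ y', d y' • b y'‖)
    (h₂ : ∀ d : m → ℂ, (∀ y, y ∉ N → d y = 0) → ‖G1 (G1 (T1 (∑ y', d y' • b y'))) - GW (G1 (T1 (∑ y', d y' • b y')))‖ ≤ κ₂ * ‖∑ y', d y' • b y'‖)
    (hS : ∀ d : m → ℂ, (∀ y, y ∉ N → d y = 0) →
      ‖S1 (G1 (G1 (T1 (∑ y', d y' • b y')))) - SW (G1 (G1 (T1 (∑ y', d y' • b y'))))‖ ≤ κS * ‖∑ y', d y' • b y'‖) :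
    ∀ d : m → ℂ, (∀ y, y ∉ N → d y = 0) →
      Real.sqrt (∑ y, ‖((M' - M) *ᵥ d) y‖ ^ 2) ≤ (κS + CS * κ₂ + CS * CG * κ₁ + CS * CG ^ 2 * κT) * Real.sqrt (∑ y, ‖d y‖ ^ 2) := by
  intro d hd
  have h := sqrt_sum_normSq_gramDiff_mulVec_le b GW G1 TW T1 SW S1 hGW hG1 hTW hT1 hM hM' hCS hCG hSW hGWb d (hT d hd) (h₁ d hd) (h₂ d hd) (hS d hd)
  have hn : ‖∑ y', d y' • b y'‖ = Real.sqrt (∑ y, ‖d y‖ ^ 2) := by rw [← norm_coordSum_sq b, Real.sqrt_sq (norm_nonneg _)]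
  rw [hn] at h
  calc Real.sqrt (∑ y, ‖((M' - M) *ᵥ d) y‖ ^ 2)
        ≤ κS * Real.sqrt (∑ y, ‖d y‖ ^ 2) + CS * (κ₂ * Real.sqrt (∑ y, ‖d y‖ ^ 2)) + CS * CG * (κ₁ * Real.sqrt (∑ y, ‖d y‖ ^ 2))
            + CS * CG ^ 2 * (κT * Real.sqrt (∑ y, ‖d y‖ ^ 2)) := h
    _ = (κS + CS * κ₂ + CS * CG * κ₁ + CS * CG ^ 2 * κT) * Real.sqrt (∑ y, ‖d y‖ ^ 2) := by ring

/-- ★★ **THE (RN) ROW `hrow` OF ✓`Prop7GramInverseDifferenceRow.gramInv_difference_row` ASSEMBLED** (= ✓`Prop7GramDifferenceNearFarSplit.gramDifference_row_of_near_far` with its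
`hA` and `hc` binders DISCHARGED here): two systems with global sizes for both (`C_S, C_G, C_T`, `C_S′, C_G′, C_T′`), `‖M′⁻¹‖ ≤ ν′`, the near row `hnear` (e.g. `hnear_of_four_rows`)
and the FAR TAIL `√Σ_{y ∉ N}‖(M′⁻¹ b_f)_y‖² ≤ τ·‖f‖` ((RN-far), the member's Gram-inverse decay × column localisation) ⟹
**`√Σ_y‖((M′ − M)(M′⁻¹ b_f))_y‖² ≤ (ε_N·(ν′·C_S·C_G) + (C_S′·C_G′²·C_T′ + C_S·C_G²·C_T)·τ)·‖f‖`**, `(b_f)_y = ⟪G_W(T_W(b_y)), f⟫` — the `hRN` of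
✓`Prop7LocalProjectorRowOfMemberRows.norm_inner_starProjection_sub_le_of_member_rows` with `δ_M := ε_N·ν′·C_S·C_G + (C_S′C_G′²C_T′ + C_SC_G²C_T)·τ`.
[cite: Balaban1985BackgroundPropagators, (3.21)–(3.26) pp.394–395, (3.105)–(3.106) p.414] -/
theorem hRN_of_near_far (b : OrthonormalBasis m ℂ C) (GW G1 : E →ₗ[ℂ] E) (TW T1 : C →ₗ[ℂ] E) (SW S1 : E →ₗ[ℂ] C)
    (hGW : ∀ x y : E, ⟪GW x, y⟫_ℂ = ⟪x, GW y⟫_ℂ) (hG1 : ∀ x y : E, ⟪G1 x, y⟫_ℂ = ⟪x, G1 y⟫_ℂ)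
    (hTW : ∀ (l : E) (c : C), ⟪SW l, c⟫_ℂ = ⟪l, TW c⟫_ℂ) (hT1 : ∀ (l : E) (c : C), ⟪S1 l, c⟫_ℂ = ⟪l, T1 c⟫_ℂ)
    {M M' : Matrix m m ℂ} (hM : ∀ y y', M y y' = ⟪GW (TW (b y)), GW (TW (b y'))⟫_ℂ) (hM' : ∀ y y', M' y y' = ⟪G1 (T1 (b y)), G1 (T1 (b y'))⟫_ℂ)
    {CS CG CT CS' CG' CT' ν' : ℝ} (hCS : 0 ≤ CS) (hCG : 0 ≤ CG) (hCT : 0 ≤ CT) (hCS' : 0 ≤ CS') (hCG' : 0 ≤ CG') (hCT' : 0 ≤ CT') (hν' : 0 ≤ ν')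
    (hSW : ∀ l, ‖SW l‖ ≤ CS * ‖l‖) (hGWb : ∀ h, ‖GW h‖ ≤ CG * ‖h‖) (hTWb : ∀ d, ‖TW d‖ ≤ CT * ‖d‖)
    (hS1 : ∀ l, ‖S1 l‖ ≤ CS' * ‖l‖) (hG1b : ∀ h, ‖G1 h‖ ≤ CG' * ‖h‖) (hT1b : ∀ d, ‖T1 d‖ ≤ CT' * ‖d‖) (hN' : ‖M'⁻¹‖ ≤ ν')
    (N : Finset m) {εN τ : ℝ} (hεN : 0 ≤ εN)
    (hnear : ∀ d : m → ℂ, (∀ y, y ∉ N → d y = 0) → Real.sqrt (∑ y, ‖((M' - M) *ᵥ d) y‖ ^ 2) ≤ εN * Real.sqrt (∑ y, ‖d y‖ ^ 2))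
    (f : E) (htail : Real.sqrt (∑ y, ‖(if y ∈ N then (0 : ℂ) else (M'⁻¹ *ᵥ fun y' => ⟪GW (TW (b y')), f⟫_ℂ) y)‖ ^ 2) ≤ τ * ‖f‖) :
    Real.sqrt (∑ y, ‖((M' - M) *ᵥ (M'⁻¹ *ᵥ fun y' => ⟪GW (TW (b y')), f⟫_ℂ)) y‖ ^ 2)
      ≤ (εN * (ν' * (CS * CG)) + (CS' * CG' ^ 2 * CT' + CS * CG ^ 2 * CT) * τ) * ‖f‖ :=
  Prop7GramDifferenceNearFarSplit.gramDifference_row_of_near_far (M' - M) N _ hεN hnear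
    (gramDiff_l2_opNorm_le b GW G1 TW T1 SW S1 hGW hG1 hTW hT1 hM hM' hCS hCG hCT hCS' hCG' hCT' hSW hGWb hTWb hS1 hG1b hT1b)
    (sqrt_sum_normSq_gramInv_coords_le b GW TW SW hGW hTW M'⁻¹ hν' hCS hN' hSW hGWb f) htail

/-! ## §4 The split shape of an absolute row (how the member discharges §2 at non-cutoff-fixed vectors) -/

/-- **ABSOLUTE ROW ⟸ LOCAL ROW + TAIL**: for linear `A, B : X → Y` with global bounds `‖A z‖ ≤ C_A‖z‖`, `‖B z‖ ≤ C_B‖z‖` and a split `x = x_in + x_out` with a LOCAL row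
`‖A x_in − B x_in‖ ≤ ρ` (at the member: `x_in` supported where the cut-off fixes it, px5's (RB1)∕(RB2)), `‖A x − B x‖ ≤ ρ + (C_A + C_B)·‖x_out‖`.
[cite: Balaban1985BackgroundPropagators, (3.105)–(3.106) p.414] -/
theorem norm_map_sub_map_le_of_split {X Y : Type*} [NormedAddCommGroup X] [NormedSpace ℂ X] [NormedAddCommGroup Y] [NormedSpace ℂ Y]
    (A B : X →ₗ[ℂ] Y) {CA CB : ℝ} (hA : ∀ z, ‖A z‖ ≤ CA * ‖z‖) (hB : ∀ z, ‖B z‖ ≤ CB * ‖z‖)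
    (x xin xout : X) (hx : x = xin + xout) {ρ : ℝ} (hloc : ‖A xin - B xin‖ ≤ ρ) :
    ‖A x - B x‖ ≤ ρ + (CA + CB) * ‖xout‖ := by
  have e : A x - B x = (A xin - B xin) + (A xout - B xout) := by rw [hx, map_add, map_add]; abel
  rw [e]
  calc ‖(A xin - B xin) + (A xout - B xout)‖ ≤ ‖A xin - B xin‖ + ‖A xout - B xout‖ := norm_add_le _ _
    _ ≤ ρ + (‖A xout‖ + ‖B xout‖) := add_le_add hloc (norm_sub_le _ _)
    _ ≤ ρ + (CA * ‖xout‖ + CB * ‖xout‖) := by gcongr <;> first | exact hA _ | exact hB _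
    _ = ρ + (CA + CB) * ‖xout‖ := by ring

/-- **ABSOLUTE ROW ⟸ RELATIVE LOCAL ROW + RELATIVE TAIL**: as `norm_map_sub_map_le_of_split` with `‖A x_in − B x_in‖ ≤ c·‖x_in‖`, `‖x_in‖ ≤ ‖x‖`, `‖x_out‖ ≤ τ·‖x‖`:
`‖A x − B x‖ ≤ (c + (C_A + C_B)·τ)·‖x‖`. [cite: Balaban1985BackgroundPropagators, (3.105)–(3.106) p.414] -/
theorem norm_map_sub_map_le_of_split_rel {X Y : Type*} [NormedAddCommGroup X] [NormedSpace ℂ X] [NormedAddCommGroup Y] [NormedSpace ℂ Y]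
    (A B : X →ₗ[ℂ] Y) {CA CB : ℝ} (hCA : 0 ≤ CA) (hCB : 0 ≤ CB) (hA : ∀ z, ‖A z‖ ≤ CA * ‖z‖) (hB : ∀ z, ‖B z‖ ≤ CB * ‖z‖)
    (x xin xout : X) (hx : x = xin + xout) {c τ : ℝ} (hc : 0 ≤ c) (hloc : ‖A xin - B xin‖ ≤ c * ‖xin‖) (hin : ‖xin‖ ≤ ‖x‖) (hout : ‖xout‖ ≤ τ * ‖x‖) :
    ‖A x - B x‖ ≤ (c + (CA + CB) * τ) * ‖x‖ := by
  have h := norm_map_sub_map_le_of_split A B hA hB x xin xout hx hloc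
  calc ‖A x - B x‖ ≤ c * ‖xin‖ + (CA + CB) * ‖xout‖ := h
    _ ≤ c * ‖x‖ + (CA + CB) * (τ * ‖x‖) := add_le_add (mul_le_mul_of_nonneg_left hin hc) (mul_le_mul_of_nonneg_left hout (add_nonneg hCA hCB))
    _ = (c + (CA + CB) * τ) * ‖x‖ := by ring

end Summit.QuantumFields.YangMills.Theorems.Prop7GramDifferenceRowSum

end
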